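import Literature.Probability.RandomPlanarGeometry.SAWTriangularHalfSpaceSurgery
import HarnessLib

/-!
# The transfer counts (P1), (P2) for HALF-SPACE WALKS of the triangular lattice

Topic `Literature/Probability/RandomPlanarGeometry` (lane «pcv-sawmu», item «TRI-HALFSPACE-RATIO»; continues
`SAWTriangularHalfSpaceSurgery.lean`). Source: N. Madras, G. Slade, *The Self-Avoiding Walk* (1993), §7.3, proof of
Theorem 7.3.2, (7.3.6)–(7.3.7), and Definition 3.1.2 (half-space walks). These are the tree's `triKesten_P1'`/`triKesten_P1`
(`SAWTriangularKestenTransfer.lean`) and `sum_card_triSlots_div_le_triSawCount`/`triKesten_P2`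
(`SAWTriangularDoubleTransfer.lean`) — equivalently the bridge versions of `SAWTriangularBridgeTransfer.lean` —
VERBATIM with the finsets `triHL`, slots `triHSlots` and count `brickHalfSpaceCount`; the proofs use only the pair
bijection and the bookkeeping constants (`1 ≤ J' ≤ J + 3`, `J ≤ J' + 2`, `I ≤ I' + 8`), which
`SAWTriangularHalfSpaceSurgery.lean` provides for half-space walks with the same constants.

## Contents (namespace `Literature.Probability.RandomPlanarGeometry.SAW`)

* `triHalfSpaceKesten_P1'`, `triHalfSpaceKesten_P1` — `#{ω' ∈ H_{N+1} : J ≥ 1} ≤ Σ_{ω ∈ H_N} I_H(ω)/max(J(ω) − 2, 1)`;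
* `sum_card_triHSlots_div_le_brickHalfSpaceCount` — `Σ_{ω' ∈ H_{N+1}} I_H(ω')/(J(ω')+3) ≤ h_{N+2}`;
* `triHalfSpaceKesten_P2` — `Σ_{ω ∈ H_N} I_H (I_H − 8)^+ /((J+3)(J+6)) ≤ h_{N+2}`.
-/

noncomputable section

open Finset
open Literature.Probability.LatticeModels Literature.Probability.Percolation SimpleGraph

namespace Literature.Probability.RandomPlanarGeometry.SAW

/-! ### (P1) for half-space walks -/

section TransferP1

/-- **(P1) for half-space walks, the first counting** (Madras–Slade (7.3.6) with inexact bookkeeping; shape of `hP1`,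
`c₁ = 2`): the number of `(N+1)`-step HALF-SPACE WALKS of `𝕋` with at least one sharp turn equals `Σ_{(ω,s)} 1/J(ins_s ω)`
over the half-space slot pairs of `H_N`, and `J(ins_s ω) ≥ max(J(ω) − 2, 1)`.
[cite: MadrasSlade1993, Theorem 7.3.2 (proof), (7.3.6), and Definition 3.1.2] -/
theorem triHalfSpaceKesten_P1' (N : ℕ) :
    (#((triHL (N + 1)).filter fun ω' => 1 ≤ #(triSharp ω')) : ℝ) ≤
      ∑ ω ∈ triHL N, (#(triHSlots ω) : ℝ) / max ((#(triSharp ω) : ℝ) - 2) 1 := by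
  -- the left side is `Σ_{ω'} J(ω') · (1/J(ω'))`, a sum over the sharp-turn pairs of `S_{N+1}`
  have hJ : (#((triHL (N + 1)).filter fun ω' => 1 ≤ #(triSharp ω')) : ℝ) =
      ∑ ω ∈ triHL (N + 1), (#(triSharp ω) : ℝ) * (1 / (#(triSharp ω) : ℝ)) := by
    rw [card_eq_sum_ones, Nat.cast_sum, sum_filter]
    refine sum_congr rfl fun ω _ => ?_
    by_cases h : 1 ≤ #(triSharp ω)
    · rw [if_pos h, Nat.cast_one, mul_one_div_cancel]
      exact_mod_cast (show #(triSharp ω) ≠ 0 by omega)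
    · rw [if_neg h, show #(triSharp ω) = 0 by omega]
      simp
  rw [hJ, ← sum_triSharpHPairs (N + 1) (fun ω => 1 / (#(triSharp ω) : ℝ)),
    ← sum_triHSlotPairs_eq_sum_triSharpHPairs N (fun p => 1 / (#(triSharp (triIns p.2.1 p.2.2 p.1)) : ℝ))
      (fun q => 1 / (#(triSharp q.1) : ℝ)) (fun p _ => rfl)]
  -- termwise `1/J(ins) ≤ 1/max(J − 2, 1)`, then re-sum over walks
  have hR : ∑ ω ∈ triHL N, (#(triHSlots ω) : ℝ) / max ((#(triSharp ω) : ℝ) - 2) 1 =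
      ∑ p ∈ triHSlotPairs N, 1 / max ((#(triSharp p.1) : ℝ) - 2) 1 := by
    rw [sum_triHSlotPairs N (fun ω => 1 / max ((#(triSharp ω) : ℝ) - 2) 1)]
    refine sum_congr rfl fun ω _ => ?_
    rw [mul_one_div]
  rw [hR]
  refine sum_le_sum fun p hp => ?_
  obtain ⟨ω, m, z⟩ := p
  rw [triHSlotPairs, mem_sigma] at hp
  dsimp only at hp ⊢
  obtain ⟨hω, hs⟩ := hp
  obtain ⟨hm, -, -, -⟩ := mem_triSlots.1 (triHSlots_subset _ hs)
  have h1 : (1 : ℝ) ≤ #(triSharp (triIns m z ω)) := by exact_mod_cast one_le_card_triSharp_triIns_of_triHL hω hs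
  have h2 : (#(triSharp ω) : ℝ) - 2 ≤ #(triSharp (triIns m z ω)) := by
    have := card_triSharp_le_triIns (z := z) (ω := ω) (le_of_lt hm)
    have h' : (#(triSharp ω) : ℝ) ≤ #(triSharp (triIns m z ω)) + 2 := by exact_mod_cast this
    linarith
  exact one_div_le_one_div_of_le (lt_of_lt_of_le one_pos (le_max_right _ _)) (max_le h2 h1)

/-- **(P1) for half-space walks**, partition form: `h_{N+1}(𝕋) − #{ω' ∈ H_{N+1} : J(ω') = 0} ≤
Σ_{ω ∈ H_N} I_H(ω)/max(1, J(ω) − 2)`. [cite: MadrasSlade1993, Theorem 7.3.2 (proof), (7.3.6), and Definition 3.1.2] -/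
theorem triHalfSpaceKesten_P1 (N : ℕ) :
    (brickHalfSpaceCount (N + 1) : ℝ) - #((triHL (N + 1)).filter fun ω => #(triSharp ω) = 0) ≤
      ∑ ω ∈ triHL N, (#(triHSlots ω) : ℝ) / max 1 ((#(triSharp ω) : ℝ) - 2) := by
  have hsplit := card_filter_add_card_filter_not (s := triHL (N + 1)) (p := fun ω => #(triSharp ω) = 0)
  rw [card_triHL] at hsplit
  have hL : (brickHalfSpaceCount (N + 1) : ℝ) - #((triHL (N + 1)).filter fun ω => #(triSharp ω) = 0) =
      #((triHL (N + 1)).filter fun ω' => 1 ≤ #(triSharp ω')) := by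
    have h : (brickHalfSpaceCount (N + 1) : ℝ) = #((triHL (N + 1)).filter fun ω => #(triSharp ω) = 0) +
        #((triHL (N + 1)).filter fun ω => ¬#(triSharp ω) = 0) := by
      exact_mod_cast hsplit.symm
    have e : ((triHL (N + 1)).filter fun ω => ¬#(triSharp ω) = 0) =
        ((triHL (N + 1)).filter fun ω' => 1 ≤ #(triSharp ω')) :=
      filter_congr fun ω _ => by omega
    rw [← e]
    linarith
  rw [hL]
  simp only [max_comm (1 : ℝ)]
  exact triHalfSpaceKesten_P1' N

end TransferP1

/-! ### (P2) for half-space walks -/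

section DoubleTransfer

/-- **Level `N+1` for half-space walks (single step of (7.3.7))**: `Σ_{ω' ∈ H_{N+1}} I_H(ω')/(J(ω')+3) ≤ h_{N+2}(𝕋)` — each
half-space slot pair `(ω', s)` is sent to the sharp-turn pair `(triIns s ω', ·)`, a half-space walk `ω''` of `H_{N+2}` receiving exactly
`J(ω'')` of them, and `J(triIns s ω') ≤ J(ω') + 3`. [cite: MadrasSlade1993, Theorem 7.3.2 (proof), eq. (7.3.7), and Definition 3.1.2] -/
theorem sum_card_triHSlots_div_le_brickHalfSpaceCount (N : ℕ) :
    ∑ ω ∈ triHL (N + 1), (#(triHSlots ω) : ℝ) / ((#(triSharp ω) : ℝ) + 3) ≤ (brickHalfSpaceCount (N + 2) : ℝ) := by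
  classical
  have e1 : ∑ ω ∈ triHL (N + 1), (#(triHSlots ω) : ℝ) / ((#(triSharp ω) : ℝ) + 3) =
      ∑ p ∈ triHSlotPairs (N + 1), 1 / ((#(triSharp p.1) : ℝ) + 3) := by
    rw [sum_triHSlotPairs (N + 1) (fun ω => 1 / ((#(triSharp ω) : ℝ) + 3))]
    exact sum_congr rfl fun ω _ => by rw [mul_one_div]
  have e2 : ∑ p ∈ triHSlotPairs (N + 1), 1 / ((#(triSharp p.1) : ℝ) + 3) ≤
      ∑ p ∈ triHSlotPairs (N + 1), 1 / (#(triSharp (triIns p.2.1 p.2.2 p.1)) : ℝ) := by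
    refine sum_le_sum fun p hp => ?_
    rw [triHSlotPairs, Finset.mem_sigma] at hp
    obtain ⟨hω, hs⟩ := hp
    have hs' : (p.2.1, p.2.2) ∈ triHSlots p.1 := hs
    have hJ1 := one_le_card_triSharp_triIns_of_triHL hω hs'
    obtain ⟨hm, -, -, -⟩ := mem_triSlots.1 (triHSlots_subset _ hs')
    have hJ3 := card_triSharp_triIns_le (z := p.2.2) (ω := p.1) (m := p.2.1) (by omega)
    have hpos : (0 : ℝ) < #(triSharp (triIns p.2.1 p.2.2 p.1)) := by exact_mod_cast hJ1
    apply one_div_le_one_div_of_le hpos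
    exact_mod_cast hJ3
  have e3 : ∑ p ∈ triHSlotPairs (N + 1), 1 / (#(triSharp (triIns p.2.1 p.2.2 p.1)) : ℝ) =
      ∑ q ∈ triSharpHPairs (N + 1 + 1), 1 / (#(triSharp q.1) : ℝ) :=
    sum_triHSlotPairs_eq_sum_triSharpHPairs (N + 1) _ (fun q => 1 / (#(triSharp q.1) : ℝ)) fun p _ => rfl
  have e4 : ∑ q ∈ triSharpHPairs (N + 1 + 1), 1 / (#(triSharp q.1) : ℝ) ≤ (brickHalfSpaceCount (N + 2) : ℝ) := by
    rw [sum_triSharpHPairs (N + 1 + 1) (fun ω => 1 / (#(triSharp ω) : ℝ)), show N + 2 = N + 1 + 1 by ring,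
      ← card_triHL, Finset.card_eq_sum_ones, Nat.cast_sum]
    refine sum_le_sum fun ω _ => ?_
    by_cases h : #(triSharp ω) = 0
    · rw [h]; simp
    · rw [mul_one_div_cancel (by exact_mod_cast h)]; simp
  rw [e1]
  exact e2.trans (e3.le.trans e4)

/-- **(P2) for half-space walks, the double transfer (Madras–Slade (7.3.7), one-step detour variant on `𝕋`)**:
`Σ_{ω ∈ H_N(𝕋)} I_H(ω) · max(0, I_H(ω) − 8) / ((J(ω)+3)(J(ω)+6)) ≤ h_{N+2}(𝕋)`, `I_H = #triHSlots`, `J = #triSharp` — two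
admissible detour insertions, counted through the half-space slot-pair/sharp-pair bijection twice, with the bookkeeping
`1 ≤ J' ≤ J + 3` and `I_H ≤ I_H' + 8` of `SAWTriangularHalfSpaceSurgery`.
[cite: MadrasSlade1993, Theorem 7.3.2 (proof), eq. (7.3.7) (p. 245), and Definition 3.1.2] -/
theorem triHalfSpaceKesten_P2 (N : ℕ) :
    ∑ ω ∈ triHL N, (#(triHSlots ω) : ℝ) * max 0 ((#(triHSlots ω) : ℝ) - 8) /
        (((#(triSharp ω) : ℝ) + 3) * ((#(triSharp ω) : ℝ) + 6)) ≤ (brickHalfSpaceCount (N + 2) : ℝ) := by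
  classical
  refine le_trans ?_ (sum_card_triHSlots_div_le_brickHalfSpaceCount N)
  -- level `N`: the weight `g(ω') = I'/((J'+3) J')`, so that `J' · g(ω') = I'/(J'+3)` when `J' ≥ 1`
  set g : List (Site 2) → ℝ := fun ω' =>
    (#(triHSlots ω') : ℝ) / (((#(triSharp ω') : ℝ) + 3) * (#(triSharp ω') : ℝ)) with hg
  have hB : ∑ ω' ∈ triHL (N + 1), (#(triSharp ω') : ℝ) * g ω' ≤
      ∑ ω' ∈ triHL (N + 1), (#(triHSlots ω') : ℝ) / ((#(triSharp ω') : ℝ) + 3) := by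
    refine sum_le_sum fun ω' _ => ?_
    by_cases h : #(triSharp ω') = 0
    · rw [h]; simp only [Nat.cast_zero, zero_mul, zero_add]; positivity
    · have hpos : (0 : ℝ) < #(triSharp ω') := by exact_mod_cast Nat.pos_of_ne_zero h
      rw [hg]
      rw [show (#(triSharp ω') : ℝ) * ((#(triHSlots ω') : ℝ) /
          (((#(triSharp ω') : ℝ) + 3) * (#(triSharp ω') : ℝ))) =
          (#(triHSlots ω') : ℝ) / ((#(triSharp ω') : ℝ) + 3) by field_simp]
  refine le_trans ?_ hB
  rw [← sum_triSharpHPairs (N + 1) g]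
  rw [← sum_triHSlotPairs_eq_sum_triSharpHPairs N (fun p => g (triIns p.2.1 p.2.2 p.1)) (fun q => g q.1) fun p _ => rfl]
  rw [show ∑ ω ∈ triHL N, (#(triHSlots ω) : ℝ) * max 0 ((#(triHSlots ω) : ℝ) - 8) /
      (((#(triSharp ω) : ℝ) + 3) * ((#(triSharp ω) : ℝ) + 6)) =
      ∑ ω ∈ triHL N, (#(triHSlots ω) : ℝ) * (max 0 ((#(triHSlots ω) : ℝ) - 8) /
      (((#(triSharp ω) : ℝ) + 3) * ((#(triSharp ω) : ℝ) + 6))) from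
    sum_congr rfl fun ω _ => by rw [mul_div_assoc]]
  rw [← sum_triHSlotPairs N (fun ω => max 0 ((#(triHSlots ω) : ℝ) - 8) /
      (((#(triSharp ω) : ℝ) + 3) * ((#(triSharp ω) : ℝ) + 6)))]
  refine sum_le_sum fun p hp => ?_
  rw [triHSlotPairs, Finset.mem_sigma] at hp
  obtain ⟨hω, hs⟩ := hp
  have hs' : (p.2.1, p.2.2) ∈ triHSlots p.1 := hs
  obtain ⟨hm, -, -, -⟩ := mem_triSlots.1 (triHSlots_subset _ hs')
  set ω' := triIns p.2.1 p.2.2 p.1 with hω'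
  have hJ1 : (1 : ℝ) ≤ #(triSharp ω') := by exact_mod_cast one_le_card_triSharp_triIns_of_triHL hω hs'
  have hJ3 : (#(triSharp ω') : ℝ) ≤ #(triSharp p.1) + 3 := by
    exact_mod_cast card_triSharp_triIns_le (z := p.2.2) (ω := p.1) (m := p.2.1) (by omega)
  have hI : (#(triHSlots p.1) : ℝ) ≤ #(triHSlots ω') + 8 := by
    exact_mod_cast card_triHSlots_le_triIns hω hs'
  have hJ0 : (0 : ℝ) ≤ #(triSharp p.1) := Nat.cast_nonneg _
  have hI0 : (0 : ℝ) ≤ #(triHSlots ω') := Nat.cast_nonneg _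
  show max 0 ((#(triHSlots p.1) : ℝ) - 8) / (((#(triSharp p.1) : ℝ) + 3) * ((#(triSharp p.1) : ℝ) + 6)) ≤ g ω'
  rw [hg]; simp only
  have hden : ((#(triSharp ω') : ℝ) + 3) * (#(triSharp ω') : ℝ) ≤
      ((#(triSharp p.1) : ℝ) + 3) * ((#(triSharp p.1) : ℝ) + 6) := by nlinarith
  have hden0 : 0 < ((#(triSharp ω') : ℝ) + 3) * (#(triSharp ω') : ℝ) := by positivity
  rcases le_or_gt ((#(triHSlots p.1) : ℝ) - 8) 0 with hneg | hpos
  · rw [max_eq_left hneg, zero_div]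
    exact div_nonneg hI0 hden0.le
  · rw [max_eq_right hpos.le]
    calc ((#(triHSlots p.1) : ℝ) - 8) / (((#(triSharp p.1) : ℝ) + 3) * ((#(triSharp p.1) : ℝ) + 6))
        ≤ ((#(triHSlots p.1) : ℝ) - 8) / (((#(triSharp ω') : ℝ) + 3) * (#(triSharp ω') : ℝ)) :=
          div_le_div_of_nonneg_left hpos.le hden0 hden
      _ ≤ (#(triHSlots ω') : ℝ) / (((#(triSharp ω') : ℝ) + 3) * (#(triSharp ω') : ℝ)) :=
          div_le_div_of_nonneg_right (by linarith) hden0.le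

end DoubleTransfer

end Literature.Probability.RandomPlanarGeometry.SAW
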